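import Mathlib
import Summits.Ventures.PercRepro2.Defs
import Summits.Ventures.PercRepro2.Harris
import Summits.Ventures.PercRepro2.Independence
import Summits.Ventures.PercRepro2.CoinDefs
import Summits.Ventures.PercRepro2.CoinReverse
import Summits.Ventures.PercRepro2.CoinStarDefs
import Summits.Ventures.PercRepro2.CoinLsmCoreDefs
import Summits.Ventures.PercRepro2.CoinLsmCoreU
import Summits.Ventures.PercRepro2.CoinCoreGate
import Summits.Ventures.PercRepro2.CoinTreeCore
import Summits.Ventures.PercRepro2.CoinD21Alg
import Summits.Ventures.PercRepro2.CoinOrTailAlg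
import Summits.Ventures.PercRepro2.CoinOrTailDefs
import Summits.Ventures.PercRepro2.CoinOrTail3Cells
import Summits.Ventures.PercRepro2.CoinOrTail3Alg
import Summits.Ventures.PercRepro2.CoinOrTailLsmDefs
import Summits.Ventures.PercRepro2.CoinOrTailLsmSums

/-!
# Row 2′DARC at an OR-TAIL on ANY LOG-SUPERMODULAR CORE, II: one far marker (blind cell
PercRepro2, night-2 g9; proofs/NIGHT2-DARC.md §37)

`darc_of_orTailLsm3`: on an OR-tail `OrTailU arcs s U r q a cρ cτ` with a log-supermodular
cluster law, the markers are `q` and a cut vertex `p` above the entry `r` (every cluster of `U`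
containing `r` contains `p`) — the five-vertex certificate `d21_cert` lifted by Ahlswede–Daykin
(`orTail3_functional_nonneg`).  `darc_of_orTailLsm3'` is the mirror image (the far marker above
the other entry).  The sums, the head properties and the adjacent-marker form are in
`CoinOrTailLsmSums`.
-/

namespace Summit.Ventures.PercRepro2.Coin

open Classical

section OrTailLsmMain

variable {V : Type*} {E : Type*} [Fintype V] [DecidableEq V] [Fintype E] [DecidableEq E]
  {R : Type*} [Field R] [LinearOrder R] [IsStrictOrderedRing R]
  {arcs : E → Finset (V × V)} {s : V} {U : Finset V} {p q a w : V} {cρ cτ : E}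


/-- **THEOREM (one far marker on a log-supermodular core).**  As `darc_of_orTailLsm` with the
tail entered at `r, q ∈ U` and a marker `p ∈ U` such that every cluster of `U` containing `r`
contains `p` (`hcut`) — the markers are `p, q`. -/
theorem darc_of_orTailLsm3 (pr : E → R) (hp : IsProbVec pr) (hS : SameEnds arcs) {r : V}
    (h : OrTailU arcs s U r q a cρ cτ) (hpU : p ∈ U)
    (hcut : ∀ W ⊆ U, r ∈ W → p ∉ W → prob pr (coreLevel arcs s U W) = 0)
    (hν : ∀ W W', W ⊆ U → W' ⊆ U →
      prob pr (coreLevel arcs s U W) * prob pr (coreLevel arcs s U W') ≤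
        prob pr (coreLevel arcs s U (W ∩ W')) * prob pr (coreLevel arcs s U (W ∪ W')))
    {t : V} (htC : t ∉ insert a U) (hts : t ≠ s) (hws : w ≠ s) (hwC : w ∉ insert a U) :
    DARC pr arcs s {t} p q a w := by
  have hC := h.closedInCoreU
  have hpa : p ≠ a := fun e => h.a_notin (e ▸ hpU)
  have hpC : p ∈ insert a U := Finset.mem_insert_of_mem hpU
  have hqC : q ∈ insert a U := Finset.mem_insert_of_mem h.q_mem
  have haC : a ∈ insert a U := Finset.mem_insert_self _ _
  unfold DARC
  rw [hC.phiC_gate_eq pr hS htC hts hpC hqC haC hws hwC]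
  have hm1 : ∀ W : Finset V, (fun _ : Finset V => (1 : R)) (insert a W) = (fun _ => (1 : R)) W :=
    fun _ => rfl
  have hmp : ∀ W : Finset V, (fun W : Finset V => if p ∈ W then (1 : R) else 0) (insert a W) =
      (fun W : Finset V => if p ∈ W then (1 : R) else 0) W := by
    intro W; simp only [Finset.mem_insert, hpa, false_or]
  have hmq : ∀ W : Finset V, (fun W : Finset V => if q ∈ W then (1 : R) else 0) (insert a W) =
      (fun W : Finset V => if q ∈ W then (1 : R) else 0) W := by
    intro W; simp only [Finset.mem_insert, h.q_ne_a, false_or]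
  have hmpq : ∀ W : Finset V,
      (fun W : Finset V => (if p ∈ W then (1 : R) else 0) * (if q ∈ W then (1 : R) else 0))
        (insert a W) =
      (fun W : Finset V => (if p ∈ W then (1 : R) else 0) * (if q ∈ W then (1 : R) else 0)) W := by
    intro W; simp only [Finset.mem_insert, hpa, h.q_ne_a, false_or]
  have eΛ := h.sum_R_eq pr t (fun _ => (1 : R)) hm1
  have eFa := h.sum_R_eq pr t (fun W => if p ∈ W then (1 : R) else 0) hmp
  have eFb := h.sum_R_eq pr t (fun W => if q ∈ W then (1 : R) else 0) hmq
  have eM := h.sum_G_eq (w := w) pr t (fun _ => (1 : R)) hm1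
  have eX := h.sum_G_eq (w := w) pr t (fun W => if p ∈ W then (1 : R) else 0) hmp
  have eY := h.sum_G_eq (w := w) pr t (fun W => if q ∈ W then (1 : R) else 0) hmq
  have eXY := h.sum_G_eq (w := w) pr t
    (fun W => (if p ∈ W then (1 : R) else 0) * (if q ∈ W then (1 : R) else 0)) hmpq
  simp only [mul_one] at eΛ eM
  rw [eΛ, eFa, eFb, eM, eX, eY, eXY]
  obtain ⟨hA0, hAmono, hAlsm⟩ := OrTailU.head_props (U := U) (a := a) pr hp hS t
  exact orTail3_functional_nonneg U (fun W => prob pr (coreLevel arcs s U W))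
    (fun X => prob pr (coreAvoidEvent arcs s t (insert a U) X)) p r q a w (pr cρ) (pr cτ)
    h.a_notin (fun hw => hwC (Finset.mem_insert_of_mem hw)) (hp.nonneg cρ) (hp.le_one cρ)
    (hp.nonneg cτ) (hp.le_one cτ) (fun W => prob_nonneg hp _)
    (fun s' hs' t' ht' => hν s' t' hs' ht') (fun W hW hr hp' => hcut W hW hr hp') hA0 hAlsm hAmono


/-- **THEOREM (one far marker on a log-supermodular core, mirror image).**  The tail entered at
`p, r ∈ U`, the markers `p` and a cut vertex `q ∈ U` above `r`. -/
theorem darc_of_orTailLsm3' (pr : E → R) (hp : IsProbVec pr) (hS : SameEnds arcs) {r : V}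
    (h : OrTailU arcs s U p r a cρ cτ) (hqU : q ∈ U)
    (hcut : ∀ W ⊆ U, r ∈ W → q ∉ W → prob pr (coreLevel arcs s U W) = 0)
    (hν : ∀ W W', W ⊆ U → W' ⊆ U →
      prob pr (coreLevel arcs s U W) * prob pr (coreLevel arcs s U W') ≤
        prob pr (coreLevel arcs s U (W ∩ W')) * prob pr (coreLevel arcs s U (W ∪ W')))
    {t : V} (htC : t ∉ insert a U) (hts : t ≠ s) (hws : w ≠ s) (hwC : w ∉ insert a U) :
    DARC pr arcs s {t} p q a w := by
  -- swap the two entries of the tail: `OrTailU … r p a cτ cρ`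
  have h' : OrTailU arcs s U r p a cτ cρ :=
    { p_mem := h.q_mem, q_mem := h.p_mem, s_notin := h.s_notin, a_notin := h.a_notin,
      a_ne_s := h.a_ne_s, into_U := h.into_U, into_s := h.into_s,
      into_a := fun e xy hxy hy => (h.into_a e xy hxy hy).symm,
      arcs_ρ := h.arcs_τ, arcs_τ := h.arcs_ρ, ρτ_ne := h.ρτ_ne.symm }
  exact DARC.symm pr (darc_of_orTailLsm3 pr hp hS h' hqU hcut hν htC hts hws hwC)


end OrTailLsmMain

end Summit.Ventures.PercRepro2.Coin
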